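import Summits.ResolutionOfSingularities.ResolutionOfSingularities.Theorems.FrobeniusLadderFRationalResolutionModelNormal
import Literature.AlgebraicGeometry.Resolution.NormalSurfaceSingularLocus
import HarnessLib

/-!
# F-rational surfaces have finitely many singular points, all closed

Route `FrobeniusLadder`, crux stmt-ResolutionOfSingularities-15317 `FRationalResolution`, line
`Sketch`. The first unconditional structural fact about the open core of the crux in dimension `2`:
an INTEGRAL F-rational `k`-scheme of finite type of dimension `≤ 2` has a finite singular locus
consisting of closed points — because F-rational stalks are normal (Hochster–Huneke 1994,
Thm. 4.2 (b), `isIntegrallyClosed_stalk_of_fRational_clause`) and normal surfaces have finitely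
many, closed, singular points (tree: `finite_compl_regularLocus_of_normal_surface`,
`isClosed_singleton_of_not_mem_regularLocus`, Lipman 1978 §2). So in dimension `2` the crux is a
statement about finitely many isolated normal (indeed F-rational, hence rational by Smith 1997)
surface singularities — exactly the residual form `cossartJannsenSaito2020_iff_isolatedSingularities`
of the named fact used in `FrobeniusLadderFRationalResolutionLowDimConditional.lean`.
-/

-- single-problem summit: the doubled namespace component `ResolutionOfSingularities` is forced
set_option linter.dupNamespace false

noncomputable section

open CategoryTheory AlgebraicGeometry TopologicalSpace
open Literature.AlgebraicGeometry.Resolution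

namespace Summit.ResolutionOfSingularities.ResolutionOfSingularities.Theorems.FRationalResolution

/-- **An integral F-rational surface has finitely many singular points.** For an integral
Noetherian scheme `X` locally of finite type over a field `k` of prime characteristic `p`, of
dimension `≤ 2`, whose stalks satisfy the F-rational clause of route `FrobeniusLadder`, the
complement of the regular locus is finite. -/
theorem finite_compl_regularLocus_of_fRational_surface (p : ℕ) (hp : p.Prime) (k : Type)
    [Field k] [CharP k p] (X : Scheme.{0}) [IsIntegral X] [IsNoetherian X] (f : X ⟶ Spec (.of k))
    [LocallyOfFiniteType f]
    (hFR : ∀ x : X, IsDomain (X.presheaf.stalk x) ∧ ∀ d : ℕ, ringKrullDim (X.presheaf.stalk x) = d →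
      ∀ s : Fin d → X.presheaf.stalk x, (Ideal.span (Set.range s)).radical.IsMaximal →
      ∀ y c : X.presheaf.stalk x, c ≠ 0 →
      (∀ e : ℕ, c * y ^ p ^ e ∈ Ideal.span ((fun z : X.presheaf.stalk x => z ^ p ^ e) ''
        (Ideal.span (Set.range s) : Set (X.presheaf.stalk x)))) → y ∈ Ideal.span (Set.range s))
    (hdim : topologicalKrullDim X ≤ 2) : (Scheme.regularLocus X)ᶜ.Finite :=
  finite_compl_regularLocus_of_normal_surface f
    (isIntegrallyClosed_stalk_of_fRational_clause p hp k X f hFR) hdim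

/-- **The singular points of an integral F-rational surface are closed points.** Same hypotheses;
every point outside the regular locus is closed (a proper generization of a singular point of a
normal surface is regular). -/
theorem isClosed_singleton_of_not_mem_regularLocus_of_fRational_surface (p : ℕ) (hp : p.Prime)
    (k : Type) [Field k] [CharP k p] (X : Scheme.{0}) [IsIntegral X] (f : X ⟶ Spec (.of k))
    [LocallyOfFiniteType f]
    (hFR : ∀ x : X, IsDomain (X.presheaf.stalk x) ∧ ∀ d : ℕ, ringKrullDim (X.presheaf.stalk x) = d →
      ∀ s : Fin d → X.presheaf.stalk x, (Ideal.span (Set.range s)).radical.IsMaximal →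
      ∀ y c : X.presheaf.stalk x, c ≠ 0 →
      (∀ e : ℕ, c * y ^ p ^ e ∈ Ideal.span ((fun z : X.presheaf.stalk x => z ^ p ^ e) ''
        (Ideal.span (Set.range s) : Set (X.presheaf.stalk x)))) → y ∈ Ideal.span (Set.range s))
    (hdim : topologicalKrullDim X ≤ 2) {x : X} (hx : x ∉ Scheme.regularLocus X) :
    IsClosed ({x} : Set X) := by
  haveI : IsLocallyNoetherian X := LocallyOfFiniteType.isLocallyNoetherian f
  exact isClosed_singleton_of_not_mem_regularLocus
    (isIntegrallyClosed_stalk_of_fRational_clause p hp k X f hFR) hdim hx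

end Summit.ResolutionOfSingularities.ResolutionOfSingularities.Theorems.FRationalResolution

end
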